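import Mathlib.Analysis.Complex.LocallyUniformLimit
import Mathlib.Analysis.Calculus.IteratedDeriv.Lemmas
import Mathlib.Analysis.Calculus.Deriv.ZPow
import Literature.NumberTheory.LFunctions.Equivalents
import Literature.NumberTheory.LFunctions.RiemannXiHadamardProduct
import Literature.NumberTheory.LFunctions.RiemannXiLogDeriv
import Literature.NumberTheory.LFunctions.LiCriterion
import Literature.NumberTheory.LFunctions.XiMoments
import HarnessLib

/-!
# The zero-sum formula for the Keiper–Li coefficients (Li 1997, (1.4)) — proved

Topic `Literature/NumberTheory/LFunctions`; sibling proofs file of `Equivalents.lean` for the named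
fact `Literature.NumberTheory.LFunctions.keiperLiCoeff_eq_zero_sum` (**rh.S26**; X.-J. Li, *The
positivity of a sequence of numbers and the Riemann hypothesis*, J. Number Theory **65** (1997),
eq. (1.4) and the display following it on p. 326; E. Bombieri, J. C. Lagarias, J. Number Theory
**77** (1999), Thm. 1): for `n ≥ 1`,

  `λₙ = (1/(n−1)!) dⁿ/dsⁿ [s^{n−1} log ξ(s)]_{s=1} = lim_{T→∞} ∑_{|Im ρ|≤T} m(ρ) [1 − (1−1/ρ)ⁿ]`,

the sum over the non-trivial zeros `ρ` of `ζ` in the boxes `liZeroBox T`, with multiplicities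
`m(ρ) = riemannZetaZeroOrder ρ`. (A second, different proofs file `EquivalentsProofs.lean` of the
same statements file treats Newman's characterisation of `Λ` and GORZ; it cannot host this proof,
being upstream of the Hadamard product of `H_t`.)

## The proof (Li 1997, p. 326)

Li: "Write `ξ(s) = ∏ (1 − s/ρ)` [(1.3)], where the product is taken over all nontrivial zeros of the
Riemann zeta function with `ρ` and `1 − ρ` being paired together … by (1.3) we have
`(1/(n−1)!) dⁿ/dsⁿ[s^{n−1} log ξ(s)]_{s=1} = −∑_ρ ∑_{k=0}^{n−1} C(n,k) (ρ−1)^{k−n}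
 = ∑_ρ [1 − (1 − 1/ρ)ⁿ]`."  Formally:

* The tree's **Hadamard product of `ξ`** (`RiemannXiHadamardProduct.lean`, from the genus-zero
  Hadamard theorem applied to de Bruijn's `H₀`): for a Hadamard sequence `b` of `H₀`
  (`exists_isHadamardSeq 0`), `ξ'/ξ(s) = ∑ₖ −4bₖ(2s−1)/(1 − bₖ(2s−1)²)` at every `s` with
  `ξ(s) ≠ 0` (`IsHadamardSeq.logDeriv_riemannXi_eq_tsum`), the `k`-th term being
  `1/(s−ρₖ) + 1/(s−(1−ρₖ))` for the pair of zeros `{ρₖ, 1−ρₖ}` (`ρₖ = xiZero b k`, `bₖ ≠ 0`).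
* `hasSum_iteratedDeriv_of_summable_norm` — a normally convergent series of holomorphic functions
  may be differentiated termwise any number of times (Weierstrass; Mathlib has the first
  derivative, `Complex.hasSum_deriv_of_summable_norm`); the series of `ξ'/ξ` converges normally on
  a disc about `s = 1` (`IsHadamardSeq.exists_summable_bound_term`), whence
  `(ξ'/ξ)^{(j)}(1) = ∑ₖ (−1)ʲ j! [(1−ρₖ)^{−j−1} + ρₖ^{−j−1}]`
  (`hasSum_iteratedDeriv_term_one`, `iteratedDeriv_term_one`).
* Leibniz' rule for `s^{n−1} · log ξ(s)` at `s = 1` (`iteratedDeriv_pow_mul_one_eq_sum`; the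
  principal `log ξ` is a primitive of `ξ'/ξ` near `1`, `iteratedDeriv_succ_log_riemannXi_one`) and
  the binomial theorem (`sum_range_choose_succ_mul_neg_pow`) give Li's display:
  `(1/(n−1)!) dⁿ/dsⁿ[…]_{s=1} = ∑ₖ ([1 − (1−1/ρₖ)ⁿ] + [1 − (1−1/(1−ρₖ))ⁿ])`, unconditionally
  convergent over the pairs (`IsHadamardSeq.hasSum_keiperLi_pairs`).
* **Bookkeeping of multiplicities**: at a zero `ρ` of `ξ` exactly `m(ρ)` Hadamard factors vanish
  (`IsHadamardSeq.natCast_card_zeroIndices_xiToH`: the factorisation `H₀ = (w−z₁)^m Q` of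
  `DeBruijnHLogDerivSeries.lean` transported along `ξ(s) = 8H₀(−i(2s−1))`, and
  `ord_ρ ξ = ord_ρ ζ`, `untop₀_meromorphicOrderAt_riemannXi`), so for every `T` the box sum
  `∑_{ρ ∈ liZeroBox T} m(ρ) F(ρ)` is the sum of `F(ρₖ) + F(1−ρₖ)` over the finitely many indices
  with `|Im ρₖ| ≤ T` (`finsum_liZeroBox_eq_sum`, double counting); these truncations are cofinal
  (`tendsto_sum_truncation`), so the box sums converge to the derivative.
* The box sums are real (`conj_finsum_liZeroBox`: the boxes are conjugation stable and
  `m(ρ̄) = m(ρ)`), so the limit equals its real part `λₙ = keiperLiCoeff n`.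

Main results: `keiperLiCoeff_eq_zero_sum_holds` (discharge of the fact) and, as both inputs of the
tree's formalisation of Li's proof of his criterion (`li_criterion_of`, `LiCriterion.lean`) are now
theorems, `li_criterion_holds : li_criterion` (**rh.S26**, Li 1997, Thm. 1: `RH ↔ ∀ n ≥ 1, λₙ ≥ 0`),
discharging `Literature.NumberTheory.LFunctions.li_criterion` (`RHConditionalFacts.lean`).

## References

* X.-J. Li, *The positivity of a sequence of numbers and the Riemann hypothesis*, J. Number Theory
  65 (1997), 325–333, Thm. 1, eqs. (1.1), (1.3), (1.4) and p. 326 (doi:10.1006/jnth.1997.2137;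
  held: `paper:doi-10-1006-jnth-1997-2137`, pp. 1–2). [Li1997]
* E. Bombieri, J. C. Lagarias, *Complements to Li's criterion for the Riemann hypothesis*,
  J. Number Theory 77 (1999), 274–287, Thm. 1, (1.2)–(1.3). [BombieriLagarias1999]
-/

noncomputable section

open Complex Filter Topology Set Metric
open scoped Nat ComplexConjugate

namespace Literature.NumberTheory.LFunctions

/-! ## Termwise iterated differentiation of a normally convergent series -/

/-- **Weierstrass, iterated.** If `∑ F_i` is a series of holomorphic functions on an open set `U`
with `‖F_i‖ ≤ u_i` on `U` and `∑ u_i < ∞`, then for every `j` and every `z ∈ U` the series of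
`j`-th derivatives converges (unconditionally) to the `j`-th derivative of the sum:
`∑_i F_i^{(j)}(z) = (∑_i F_i)^{(j)}(z)` (Mathlib's `Complex.hasSum_deriv_of_summable_norm` is the
case `j = 1`; iterate `TendstoLocallyUniformlyOn.deriv`). [folklore] -/
theorem hasSum_iteratedDeriv_of_summable_norm {ι : Type*} {F : ι → ℂ → ℂ} {U : Set ℂ}
    {u : ι → ℝ} (hu : Summable u) (hf : ∀ i, DifferentiableOn ℂ (F i) U) (hU : IsOpen U)
    (hF_le : ∀ i w, w ∈ U → ‖F i w‖ ≤ u i) (j : ℕ) {z : ℂ} (hz : z ∈ U) :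
    HasSum (fun i ↦ iteratedDeriv j (F i) z) (iteratedDeriv j (fun w ↦ ∑' i, F i w) z) := by
  classical
  have hS : ∀ s : Finset ι, DifferentiableOn ℂ (fun w ↦ ∑ i ∈ s, F i w) U :=
    fun s ↦ DifferentiableOn.fun_sum fun i _ ↦ hf i
  have hSan : ∀ (s : Finset ι) (j : ℕ),
      AnalyticOnNhd ℂ (iteratedDeriv j fun w ↦ ∑ i ∈ s, F i w) U := by
    intro s j
    rw [iteratedDeriv_eq_iterate]
    exact ((hS s).analyticOnNhd hU).iterated_deriv j
  have key : ∀ j : ℕ, TendstoLocallyUniformlyOn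
      (fun (s : Finset ι) ↦ iteratedDeriv j (fun w ↦ ∑ i ∈ s, F i w))
      (iteratedDeriv j (fun w ↦ ∑' i, F i w)) atTop U := by
    intro j
    induction j with
    | zero =>
      simpa using (tendstoUniformlyOn_tsum hu hF_le).tendstoLocallyUniformlyOn
    | succ j ih =>
      have h := ih.deriv (Eventually.of_forall fun s ↦ (hSan s j).differentiableOn) hU
      simpa [iteratedDeriv_succ, Function.comp_def] using h
  have h1 := (key j).tendsto_at hz
  have h2 : ∀ s : Finset ι, iteratedDeriv j (fun w ↦ ∑ i ∈ s, F i w) z =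
      ∑ i ∈ s, iteratedDeriv j (F i) z := fun s ↦
    iteratedDeriv_fun_sum fun i _ ↦ (((hf i).analyticOnNhd hU) z hz).contDiffAt
  simp only [h2] at h1
  exact h1

/-! ## Calculus at `s = 1` -/

/-- **Leibniz' rule for `s^{n−1} g(s)` at `s = 1`**: for `n ≥ 1` and `g` of class `Cⁿ` at `1`,
`dⁿ/dsⁿ[s^{n−1} g(s)]|_{s=1} = ∑_{j<n} C(n,j+1) · (n−1)!/j! · g^{(j+1)}(1)`
(the term without derivative on `g` vanishes as `dⁿ/dsⁿ s^{n−1} = 0`). [folklore] -/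
theorem iteratedDeriv_pow_mul_one_eq_sum {g : ℂ → ℂ} {n : ℕ} (hn : 1 ≤ n)
    (hg : ContDiffAt ℂ n g 1) :
    iteratedDeriv n (fun s ↦ s ^ (n - 1) * g s) 1 =
      ∑ j ∈ Finset.range n,
        (n.choose (j + 1) : ℂ) * (((n - 1)! : ℂ) / (j ! : ℂ)) * iteratedDeriv (j + 1) g 1 := by
  have hp : ContDiffAt ℂ n (fun s : ℂ ↦ s ^ (n - 1)) 1 := (contDiff_id.pow _).contDiffAt
  rw [iteratedDeriv_fun_mul hp hg]
  simp only [iteratedDeriv_pow, one_pow, mul_one]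
  rw [Finset.sum_range_succ, Nat.descFactorial_eq_zero_iff_lt.2 (by omega : n - 1 < n)]
  simp only [Nat.cast_zero, mul_zero, zero_mul, add_zero]
  conv_lhs => rw [← Finset.sum_range_reflect]
  refine Finset.sum_congr rfl fun j hj ↦ ?_
  have hj' : j < n := Finset.mem_range.1 hj
  have e1 : n - 1 - j = n - (j + 1) := by omega
  have e2 : n - (n - 1 - j) = j + 1 := by omega
  rw [e2, e1, Nat.choose_symm (by omega : j + 1 ≤ n)]
  congr 2
  have key : ((n - 1).descFactorial (n - (j + 1)) : ℂ) * (j ! : ℂ) = ((n - 1)! : ℂ) := by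
    have h := Nat.factorial_mul_descFactorial (show n - (j + 1) ≤ n - 1 by omega)
    rw [show n - 1 - (n - (j + 1)) = j by omega, mul_comm] at h
    exact_mod_cast h
  have hj0 : (j ! : ℂ) ≠ 0 := by exact_mod_cast (Nat.factorial_pos j).ne'
  field_simp
  exact key

/-- Near `s = 1` the principal `log ξ` is a primitive of `ξ'/ξ` (`ξ(1) = ½ > 0`), hence
`(log ξ)^{(j+1)}(1) = (ξ'/ξ)^{(j)}(1)`. [folklore] -/
theorem iteratedDeriv_succ_log_riemannXi_one (j : ℕ) :
    iteratedDeriv (j + 1) (fun s ↦ Complex.log (riemannXi s)) 1 =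
      iteratedDeriv j (logDeriv riemannXi) 1 := by
  rw [iteratedDeriv_succ']
  refine Filter.EventuallyEq.iteratedDeriv_eq j ?_
  have h1 : riemannXi 1 ∈ slitPlane := by
    rw [riemannXi_one, mem_slitPlane_iff]; norm_num
  have hV : ∀ᶠ s in 𝓝 (1 : ℂ), riemannXi s ∈ slitPlane :=
    differentiable_riemannXi.continuous.continuousAt.eventually_mem (isOpen_slitPlane.mem_nhds h1)
  filter_upwards [hV] with s hs
  rw [((differentiable_riemannXi s).hasDerivAt.clog hs).deriv, logDeriv_apply]

/-- A closed disc `|s − 1| ≤ r` (`0 < r ≤ 1/2`) on which `ξ` has no zeros (`ξ(1) = ½ ≠ 0` and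
continuity). [folklore] -/
theorem exists_closedBall_one_riemannXi_ne_zero :
    ∃ r : ℝ, 0 < r ∧ r ≤ 1 / 2 ∧ ∀ s ∈ closedBall (1 : ℂ) r, riemannXi s ≠ 0 := by
  have h1 : riemannXi 1 ≠ 0 := by rw [riemannXi_one]; norm_num
  have hev : ∀ᶠ s in 𝓝 (1 : ℂ), riemannXi s ≠ 0 :=
    differentiable_riemannXi.continuous.continuousAt.eventually_ne h1
  obtain ⟨ε, hε, hball⟩ := Metric.eventually_nhds_iff_ball.1 hev
  refine ⟨min (ε / 2) (1 / 2), by positivity, min_le_right _ _, fun s hs ↦ hball s ?_⟩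
  exact closedBall_subset_ball (lt_of_le_of_lt (min_le_left _ _) (by linarith)) hs

/-- **Binomial identity** behind Li's coefficients:
`∑_{j<n} C(n,j+1) (−1)ʲ x^{j+1} = 1 − (1 − x)ⁿ`. [folklore] -/
theorem sum_range_choose_succ_mul_neg_pow (x : ℂ) (n : ℕ) :
    ∑ j ∈ Finset.range n, (n.choose (j + 1) : ℂ) * ((-1) ^ j * x ^ (j + 1)) =
      1 - (1 - x) ^ n := by
  have h := add_pow (-x) 1 n
  rw [Finset.sum_range_succ'] at h
  simp only [one_pow, mul_one, pow_zero, Nat.choose_zero_right, Nat.cast_one] at h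
  have e : (1 - x) ^ n = (-x + 1) ^ n := by ring_nf
  rw [e, h]
  have e2 : (1 : ℂ) - (∑ j ∈ Finset.range n, (-x) ^ (j + 1) * (n.choose (j + 1) : ℂ) + 1) =
      ∑ j ∈ Finset.range n, -((-x) ^ (j + 1) * (n.choose (j + 1) : ℂ)) := by
    rw [Finset.sum_neg_distrib]; ring
  rw [e2]
  refine Finset.sum_congr rfl fun j _ ↦ ?_
  rw [neg_pow x, pow_succ (-1 : ℂ) j]
  ring

/-! ## The partial-fraction series of `ξ'/ξ`, differentiated termwise at `s = 1` -/

namespace IsHadamardSeq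

variable {b : ℕ → ℂ}

/-- `xiToH` is differentiable. [folklore] -/
theorem differentiable_xiToH : Differentiable ℂ xiToH := fun s ↦
  (hasDerivAt_xiToH s).differentiableAt

/-- The terms `−4bₖ(2s−1)/(1 − bₖ(2s−1)²)` of `ξ'/ξ` are holomorphic off the zeros of `ξ`.
[folklore] -/
theorem differentiableOn_term (h : IsHadamardSeq 0 b) (k : ℕ) :
    DifferentiableOn ℂ (fun s ↦ -(4 * b k * (2 * s - 1)) / (1 - b k * (2 * s - 1) ^ 2))
      {s | riemannXi s ≠ 0} := by
  refine DifferentiableOn.div (by fun_prop) (by fun_prop) fun s hs ↦ h.factor_ne_zero' hs k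

/-- **Normal convergence near `s = 1`.** On a disc `|s − 1| < r` whose closure avoids the zeros of
`ξ` (`r ≤ 1/2`), the terms of `ξ'/ξ` are bounded by a summable sequence: `16‖bₖ‖` as soon as
`‖bₖ‖ ≤ 1/8`, and a compactness bound for the finitely many other `k`. [folklore] -/
theorem exists_summable_bound_term (h : IsHadamardSeq 0 b) {r : ℝ} (hr : 0 < r) (hr2 : r ≤ 1 / 2)
    (hξ : ∀ s ∈ closedBall (1 : ℂ) r, riemannXi s ≠ 0) :
    ∃ u : ℕ → ℝ, Summable u ∧ ∀ k, ∀ w ∈ ball (1 : ℂ) r,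
      ‖-(4 * b k * (2 * w - 1)) / (1 - b k * (2 * w - 1) ^ 2)‖ ≤ u k := by
  classical
  -- compactness bound for each `k`
  have hbd : ∀ k, ∃ M : ℝ, ∀ w ∈ closedBall (1 : ℂ) r,
      ‖-(4 * b k * (2 * w - 1)) / (1 - b k * (2 * w - 1) ^ 2)‖ ≤ M := by
    intro k
    refine (isCompact_closedBall (1 : ℂ) r).exists_bound_of_continuousOn ?_
    exact ((h.differentiableOn_term k).mono fun w hw ↦ hξ w hw).continuousOn
  choose M hM using hbd
  refine ⟨fun k ↦ if ‖b k‖ ≤ 1 / 8 then 16 * ‖b k‖ else M k, ?_, ?_⟩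
  · -- summable: eventually the first branch
    refine Summable.of_norm_bounded_eventually (g := fun k ↦ 16 * ‖b k‖)
      (h.summable.mul_left 16) ?_
    have hev : ∀ᶠ k in cofinite, ‖b k‖ ≤ 1 / 8 := by
      have := (Summable.of_norm h.summable).tendsto_cofinite_zero.norm
      rw [norm_zero] at this
      exact (this.eventually (ge_mem_nhds (by norm_num : (0 : ℝ) < 1 / 8)))
    filter_upwards [hev] with k hk
    simp only [hk, if_true, Real.norm_eq_abs]
    rw [abs_of_nonneg (by positivity)]
  · intro k w hw
    have hw' : w ∈ closedBall (1 : ℂ) r := ball_subset_closedBall hw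
    beta_reduce
    split_ifs with hk
    · -- the small terms
      have h2w : ‖2 * w - 1‖ ≤ 2 := by
        have : ‖w - 1‖ < r := by simpa [dist_eq_norm] using hw
        calc ‖2 * w - 1‖ = ‖2 * (w - 1) + 1‖ := by ring_nf
          _ ≤ ‖2 * (w - 1)‖ + ‖(1 : ℂ)‖ := norm_add_le _ _
          _ ≤ 2 * r + 1 := by
            rw [norm_mul, Complex.norm_two, norm_one]; nlinarith [norm_nonneg (w - 1)]
          _ ≤ 2 := by linarith
      have hsq : ‖b k * (2 * w - 1) ^ 2‖ ≤ 1 / 2 := by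
        rw [norm_mul, norm_pow]
        nlinarith [norm_nonneg (b k), norm_nonneg (2 * w - 1)]
      have hden : 1 / 2 ≤ ‖1 - b k * (2 * w - 1) ^ 2‖ := by
        have := norm_sub_norm_le (1 : ℂ) (b k * (2 * w - 1) ^ 2)
        rw [norm_one] at this
        linarith
      have hnum : ‖-(4 * b k * (2 * w - 1))‖ ≤ 8 * ‖b k‖ := by
        rw [norm_neg, norm_mul, norm_mul, Complex.norm_ofNat]
        nlinarith [norm_nonneg (b k), norm_nonneg (2 * w - 1)]
      rw [norm_div, div_le_iff₀ (by linarith)]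
      nlinarith [norm_nonneg (b k)]
    · exact hM k w hw'

/-- **The derivatives of `ξ'/ξ` at `s = 1`, termwise**: for a Hadamard sequence `b` of `H₀` and
every `j`, `(ξ'/ξ)^{(j)}(1) = ∑ₖ dʲ/dsʲ[−4bₖ(2s−1)/(1 − bₖ(2s−1)²)]|_{s=1}` (unconditionally
convergent): the partial-fraction series `ξ'/ξ(s) = ∑ₖ −4bₖ(2s−1)/(1 − bₖ(2s−1)²)`
(`logDeriv_riemannXi_eq_tsum`) converges normally near `s = 1`, so it may be differentiated term by
term (Li 1997, p. 326: "by (1.3) we have …", differentiating the logarithm of the Hadamard product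
(1.3)). [cite: Li1997, p. 326] -/
theorem hasSum_iteratedDeriv_term_one (h : IsHadamardSeq 0 b) (j : ℕ) :
    HasSum
      (fun k ↦ iteratedDeriv j (fun s ↦ -(4 * b k * (2 * s - 1)) / (1 - b k * (2 * s - 1) ^ 2)) 1)
      (iteratedDeriv j (logDeriv riemannXi) 1) := by
  obtain ⟨r, hr, hr2, hξ⟩ := exists_closedBall_one_riemannXi_ne_zero
  obtain ⟨u, hu, hle⟩ := h.exists_summable_bound_term hr hr2 hξ
  have hU : IsOpen (ball (1 : ℂ) r) := isOpen_ball
  have h1 : (1 : ℂ) ∈ ball (1 : ℂ) r := mem_ball_self hr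
  have hdiff : ∀ k, DifferentiableOn ℂ
      (fun s ↦ -(4 * b k * (2 * s - 1)) / (1 - b k * (2 * s - 1) ^ 2)) (ball (1 : ℂ) r) :=
    fun k ↦ (h.differentiableOn_term k).mono fun w hw ↦ hξ w (ball_subset_closedBall hw)
  have H := hasSum_iteratedDeriv_of_summable_norm hu hdiff hU hle j h1
  -- the sum of the series is `ξ'/ξ` on the disc
  have heq : EqOn (fun w ↦ ∑' k, -(4 * b k * (2 * w - 1)) / (1 - b k * (2 * w - 1) ^ 2))
      (logDeriv riemannXi) (ball (1 : ℂ) r) := fun w hw ↦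
    (h.logDeriv_riemannXi_eq_tsum (hξ w (ball_subset_closedBall hw))).symm
  rwa [heq.iteratedDeriv_of_isOpen hU j h1] at H

/-- **The derivatives of one pair of terms at `s = 1`**: for `bₖ ≠ 0`, near `s = 1` the `k`-th term
is `1/(s−ρₖ) + 1/(s−(1−ρₖ))`, so its `j`-th derivative at `1` is
`(−1)ʲ j! [(1−ρₖ)^{−(j+1)} + ρₖ^{−(j+1)}]`. [folklore] -/
theorem iteratedDeriv_term_one (h : IsHadamardSeq 0 b) {k : ℕ} (hk : b k ≠ 0) (j : ℕ) :
    iteratedDeriv j (fun s ↦ -(4 * b k * (2 * s - 1)) / (1 - b k * (2 * s - 1) ^ 2)) 1 =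
      (-1) ^ j * j ! * (((1 - xiZero b k)⁻¹) ^ (j + 1) + ((xiZero b k)⁻¹) ^ (j + 1)) := by
  set ρ := xiZero b k with hρ
  have hρ0 : riemannXi ρ = 0 := h.riemannXi_xiZero hk
  have hρ1 : riemannXi (1 - ρ) = 0 := h.riemannXi_one_sub_xiZero hk
  -- near `1` the term is `(s − ρ)⁻¹ + (s − (1 − ρ))⁻¹`
  have h1 : riemannXi 1 ≠ 0 := by rw [riemannXi_one]; norm_num
  have hev : ∀ᶠ s in 𝓝 (1 : ℂ), riemannXi s ≠ 0 :=
    differentiable_riemannXi.continuous.continuousAt.eventually_ne h1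
  have hfe : (fun s ↦ -(4 * b k * (2 * s - 1)) / (1 - b k * (2 * s - 1) ^ 2)) =ᶠ[𝓝 1]
      fun s ↦ (1 * s - ρ)⁻¹ + (1 * s - (1 - ρ))⁻¹ := by
    filter_upwards [hev] with s hs
    have hs1 : s ≠ ρ := fun e ↦ hs (by rw [e]; exact hρ0)
    have hs2 : s ≠ 1 - ρ := fun e ↦ hs (by rw [e]; exact hρ1)
    rw [term_eq_inv_add_inv b hk hs1 hs2]
    simp only [one_div, one_mul]
    rfl
  rw [hfe.iteratedDeriv_eq]
  have hne1 : (1 : ℂ) - ρ ≠ 0 := fun e ↦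
    h1 (by rw [show (1 : ℂ) = 1 - ρ + ρ by ring, e, zero_add]; exact hρ0)
  have hne2 : (1 : ℂ) - (1 - ρ) ≠ 0 := by
    rw [sub_sub_cancel]
    intro e; rw [e] at hρ0; rw [riemannXi_zero] at hρ0; norm_num at hρ0
  have hc1 : ContDiffAt ℂ j (fun s : ℂ ↦ (1 * s - ρ)⁻¹) 1 := by
    refine ContDiffAt.inv (by fun_prop) (by simpa using hne1)
  have hc2 : ContDiffAt ℂ j (fun s : ℂ ↦ (1 * s - (1 - ρ))⁻¹) 1 := by
    refine ContDiffAt.inv (by fun_prop) (by simpa using hne2)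
  rw [iteratedDeriv_fun_add hc1 hc2, iteratedDeriv_eq_iterate, iteratedDeriv_eq_iterate,
    iter_deriv_inv_linear_sub j 1 ρ, iter_deriv_inv_linear_sub j 1 (1 - ρ)]
  simp only [one_pow, mul_one, sub_sub_cancel]
  have ez : ∀ a : ℂ, a ^ (-1 - j : ℤ) = (a⁻¹) ^ (j + 1) := by
    intro a
    rw [show (-1 - j : ℤ) = -((j + 1 : ℕ) : ℤ) by push_cast; ring, zpow_neg, zpow_natCast, inv_pow]
  rw [ez, ez]
  ring

/-- **Li's computation, term by term** (Li 1997, p. 326, the display after (1.4): "by (1.3) we have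
`(1/(n−1)!) dⁿ/dsⁿ[s^{n−1} log ξ(s)]_{s=1} = −∑_ρ ∑_{k<n} C(n,k) (ρ−1)^{k−n} = ∑_ρ [1 − (1−1/ρ)ⁿ]`";
Bombieri–Lagarias 1999, proof of Thm. 1): for a Hadamard sequence `b` of `H₀` and `n ≥ 1`,
`(1/(n−1)!) dⁿ/dsⁿ[s^{n−1} log ξ(s)]|_{s=1} = ∑ₖ ([1 − (1 − 1/ρₖ)ⁿ] + [1 − (1 − 1/(1−ρₖ))ⁿ])`,
summed over the pairs `{ρₖ, 1 − ρₖ}` of the Hadamard product (unconditionally convergent; the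
padding indices `bₖ = 0` contribute `0`). [cite: Li1997, p. 326] -/
theorem hasSum_keiperLi_pairs (h : IsHadamardSeq 0 b) {n : ℕ} (hn : 1 ≤ n) :
    HasSum (fun k ↦ if b k = 0 then (0 : ℂ) else
        ((1 - (1 - 1 / xiZero b k) ^ n) + (1 - (1 - 1 / (1 - xiZero b k)) ^ n)))
      (iteratedDeriv n (fun s : ℂ ↦ s ^ (n - 1) * Complex.log (riemannXi s)) 1 /
        ((n - 1)! : ℂ)) := by
  have hg : ContDiffAt ℂ n (fun s ↦ Complex.log (riemannXi s)) 1 :=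
    analyticAt_log_riemannXi_one.contDiffAt
  have hsum := hasSum_sum (s := Finset.range n)
    (f := fun j k ↦ (n.choose (j + 1) : ℂ) / (j ! : ℂ) *
      iteratedDeriv j (fun s ↦ -(4 * b k * (2 * s - 1)) / (1 - b k * (2 * s - 1) ^ 2)) 1)
    fun j _ ↦ (h.hasSum_iteratedDeriv_term_one j).mul_left ((n.choose (j + 1) : ℂ) / (j ! : ℂ))
  convert hsum using 1
  · funext k
    split_ifs with hk
    · simp [hk]
    · simp only [h.iteratedDeriv_term_one hk]
      have hj : ∀ j ∈ Finset.range n, (n.choose (j + 1) : ℂ) / (j ! : ℂ) *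
          ((-1) ^ j * j ! * (((1 - xiZero b k)⁻¹) ^ (j + 1) + ((xiZero b k)⁻¹) ^ (j + 1))) =
          (n.choose (j + 1) : ℂ) * ((-1) ^ j * ((1 - xiZero b k)⁻¹) ^ (j + 1)) +
          (n.choose (j + 1) : ℂ) * ((-1) ^ j * ((xiZero b k)⁻¹) ^ (j + 1)) := by
        intro j _
        have hj0 : (j ! : ℂ) ≠ 0 := by exact_mod_cast (Nat.factorial_pos j).ne'
        field_simp
      rw [Finset.sum_congr rfl hj, Finset.sum_add_distrib, sum_range_choose_succ_mul_neg_pow,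
        sum_range_choose_succ_mul_neg_pow]
      simp only [one_div]
      ring
  · rw [iteratedDeriv_pow_mul_one_eq_sum hn hg, Finset.sum_div]
    refine Finset.sum_congr rfl fun j _ ↦ ?_
    rw [iteratedDeriv_succ_log_riemannXi_one]
    have h0 : ((n - 1)! : ℂ) ≠ 0 := by exact_mod_cast (Nat.factorial_pos _).ne'
    have hj0 : (j ! : ℂ) ≠ 0 := by exact_mod_cast (Nat.factorial_pos j).ne'
    field_simp

/-! ## The multiset of zeros: Hadamard indices versus `m(ρ) = riemannZetaZeroOrder ρ` -/

/-- The indices of the Hadamard factors vanishing at `ρ` (i.e. at `z = xiToH ρ`) are the `k` with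
`bₖ ≠ 0` and `ρ ∈ {ρₖ, 1 − ρₖ}`. [folklore] -/
theorem mem_zeroIndices_xiToH_iff (h : IsHadamardSeq 0 b) {ρ : ℂ} {k : ℕ} :
    k ∈ h.zeroIndices (xiToH ρ) ↔ b k ≠ 0 ∧ (ρ = xiZero b k ∨ ρ = 1 - xiZero b k) := by
  rw [h.mem_zeroIndices, xiToH_sq]
  by_cases hk : b k = 0
  · simp [hk]
  · have e : 1 + b k * -(2 * ρ - 1) ^ 2 = 1 - b k * (2 * ρ - 1) ^ 2 := by ring
    rw [e, factor_eq_mul b hk ρ]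
    simp only [neg_mul, neg_eq_zero, mul_eq_zero, hk, or_false, sub_eq_zero, ne_eq,
      not_false_eq_true, true_and, OfNat.ofNat_ne_zero, false_or]

/-- **Multiplicities.** At a zero `ρ` of `ξ`, the number of Hadamard factors vanishing at `ρ` is the
multiplicity `m(ρ) = riemannZetaZeroOrder ρ` of `ρ` as a zero of `ζ`: transport the factorisation
`H₀(w) = (w − z₁)^m Q(w)` (`eq_pow_mul_cofactor`, `m = #zeroIndices`) along `ξ(s) = 8H₀(−i(2s−1))`
to `ξ(s) = (s−ρ)^m · 8(−2i)^m Q(xiToH s)`, and use `ord_ρ ξ = ord_ρ ζ` in the critical strip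
(`untop₀_meromorphicOrderAt_riemannXi`). [folklore] -/
theorem natCast_card_zeroIndices_xiToH (h : IsHadamardSeq 0 b) {ρ : ℂ} (hρ : riemannXi ρ = 0) :
    ((h.zeroIndices (xiToH ρ)).card : ℤ) = riemannZetaZeroOrder ρ := by
  obtain ⟨-, h0, h1, -⟩ := riemannXi_zero_prop hρ
  have hρ1 : ρ ≠ 1 := fun e ↦ by rw [e] at h1; simp at h1
  have hH : deBruijnH 0 (xiToH ρ) = 0 := by
    have e := riemannXi_eq_deBruijnH ρ
    rw [hρ] at e
    rcases mul_eq_zero.1 e.symm with h8 | hH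
    · norm_num at h8
    · exact hH
  set z₁ := xiToH ρ with hz₁
  have hlin : ∀ s, xiToH s - z₁ = (-2 * I) * (s - ρ) := by
    intro s; simp only [hz₁, xiToH]; ring
  have hfac : ∀ s, riemannXi s =
      (s - ρ) ^ h.mult z₁ • (8 * (-2 * I) ^ h.mult z₁ * h.cofactor z₁ (xiToH s)) := by
    intro s
    rw [riemannXi_eq_deBruijnH s, h.eq_pow_mul_cofactor hH (xiToH s), hlin s, mul_pow, smul_eq_mul]
    ring
  have hQa : AnalyticAt ℂ (fun s ↦ 8 * (-2 * I) ^ h.mult z₁ * h.cofactor z₁ (xiToH s)) ρ := by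
    have hd : Differentiable ℂ (fun s ↦ 8 * (-2 * I) ^ h.mult z₁ * h.cofactor z₁ (xiToH s)) :=
      (differentiable_const _).mul ((h.differentiable_cofactor z₁).comp differentiable_xiToH)
    exact hd.analyticAt ρ
  have hQ0 : (8 * (-2 * I) ^ h.mult z₁ * h.cofactor z₁ (xiToH ρ)) ≠ 0 :=
    mul_ne_zero (mul_ne_zero (by norm_num) (pow_ne_zero _ (by simp))) (h.cofactor_self_ne_zero hH)
  have horder : analyticOrderAt riemannXi ρ = h.mult z₁ := by
    rw [(differentiable_riemannXi.analyticAt ρ).analyticOrderAt_eq_natCast]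
    exact ⟨_, hQa, hQ0, Eventually.of_forall hfac⟩
  rw [← untop₀_meromorphicOrderAt_riemannXi h0 hρ1,
    (differentiable_riemannXi.analyticAt ρ).meromorphicOrderAt_eq, horder]
  simp [IsHadamardSeq.mult]

/-- A zero `ρ` of a box `liZeroBox T` is a zero of `ξ` (it is a non-trivial zero of `ζ`: off the
real axis, hence in the open strip). [folklore] -/
theorem riemannXi_eq_zero_of_mem_liZeroBox {T : ℝ} {ρ : ℂ} (hρ : ρ ∈ liZeroBox T) :
    riemannXi ρ = 0 := by
  obtain ⟨hζ, -, -, him, -⟩ := hρ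
  have him' : ρ.im ≠ 0 := abs_pos.1 him
  obtain ⟨h0, h1⟩ := re_mem_Ioo_of_riemannZeta_eq_zero_of_im_ne_zero hζ him'
  exact (riemannXi_eq_zero_iff_holds ρ).2 ⟨hζ, h0, h1⟩

/-- The chosen zero `ρₖ` (`bₖ ≠ 0`) lies in the box `liZeroBox T` as soon as `|Im ρₖ| ≤ T`.
[folklore] -/
theorem xiZero_mem_liZeroBox (h : IsHadamardSeq 0 b) {k : ℕ} (hk : b k ≠ 0) {T : ℝ}
    (hT : |(xiZero b k).im| ≤ T) : xiZero b k ∈ liZeroBox T := by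
  obtain ⟨hζ, h0, h1, him⟩ := riemannXi_zero_prop (h.riemannXi_xiZero hk)
  exact ⟨hζ, h0.le, h1.le, abs_pos.2 him, hT⟩

/-- … and so does `1 − ρₖ`. [folklore] -/
theorem one_sub_xiZero_mem_liZeroBox (h : IsHadamardSeq 0 b) {k : ℕ} (hk : b k ≠ 0) {T : ℝ}
    (hT : |(xiZero b k).im| ≤ T) : 1 - xiZero b k ∈ liZeroBox T := by
  obtain ⟨hζ, h0, h1, him⟩ := riemannXi_zero_prop (h.riemannXi_one_sub_xiZero hk)
  refine ⟨hζ, h0.le, h1.le, abs_pos.2 him, ?_⟩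
  simpa using hT

/-- `ρₖ ≠ 1 − ρₖ` (`bₖ ≠ 0`): the zeros of `ξ` are off the real axis. [folklore] -/
theorem xiZero_ne_one_sub (h : IsHadamardSeq 0 b) {k : ℕ} (hk : b k ≠ 0) :
    xiZero b k ≠ 1 - xiZero b k := by
  obtain ⟨-, -, -, him⟩ := riemannXi_zero_prop (h.riemannXi_xiZero hk)
  intro e
  have := congrArg Complex.im e
  simp only [sub_im, one_im, zero_sub] at this
  exact him (by linarith)

/-- **Double counting.** For every `T` and every `F`, the box sum with multiplicities equals the
sum over the Hadamard indices with `|Im ρₖ| ≤ T` of `F(ρₖ) + F(1 − ρₖ)`: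
`∑_{ρ ∈ liZeroBox T} m(ρ) F(ρ) = ∑_{k : bₖ ≠ 0, |Im ρₖ| ≤ T} [F(ρₖ) + F(1−ρₖ)]`
(each `ρ` of the box is hit by exactly `m(ρ)` indices, `natCast_card_zeroIndices_xiToH`, and each
index hits exactly the two distinct points `ρₖ, 1 − ρₖ` of the box). [folklore] -/
theorem finsum_liZeroBox_eq_sum (h : IsHadamardSeq 0 b) (F : ℂ → ℂ) (T : ℝ) (K : Finset ℕ)
    (hK : ∀ k, k ∈ K ↔ b k ≠ 0 ∧ |(xiZero b k).im| ≤ T) :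
    ∑ᶠ ρ ∈ liZeroBox T, (riemannZetaZeroOrder ρ : ℂ) * F ρ =
      ∑ k ∈ K, (F (xiZero b k) + F (1 - xiZero b k)) := by
  classical
  rw [finsum_mem_eq_finite_toFinset_sum _ (liZeroBox_finite T)]
  set B := (liZeroBox_finite T).toFinset with hB
  have hBmem : ∀ ρ, ρ ∈ B ↔ ρ ∈ liZeroBox T := fun ρ ↦ Set.Finite.mem_toFinset _
  -- every index of a factor vanishing on the box lies in `K`
  have hsub : ∀ ρ ∈ B, h.zeroIndices (xiToH ρ) ⊆ K := by
    intro ρ hρ k hk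
    obtain ⟨hbk, hρk⟩ := h.mem_zeroIndices_xiToH_iff.1 hk
    obtain ⟨-, -, -, -, hT⟩ := (hBmem ρ).1 hρ
    refine (hK k).2 ⟨hbk, ?_⟩
    rcases hρk with e | e
    · rwa [e] at hT
    · rw [e] at hT; simpa using hT
  -- step 1: `m(ρ) F(ρ) = ∑_{k ∈ K} [k ∈ zeroIndices ρ] F(ρ)`
  have step1 : ∀ ρ ∈ B, (riemannZetaZeroOrder ρ : ℂ) * F ρ =
      ∑ k ∈ K, if k ∈ h.zeroIndices (xiToH ρ) then F ρ else 0 := by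
    intro ρ hρ
    rw [Finset.sum_ite_mem, Finset.inter_eq_right.2 (hsub ρ hρ), Finset.sum_const, nsmul_eq_mul,
      ← h.natCast_card_zeroIndices_xiToH (riemannXi_eq_zero_of_mem_liZeroBox ((hBmem ρ).1 hρ)),
      Int.cast_natCast]
  rw [Finset.sum_congr rfl step1, Finset.sum_comm]
  refine Finset.sum_congr rfl fun k hk ↦ ?_
  obtain ⟨hbk, hT⟩ := (hK k).1 hk
  rw [← Finset.sum_filter]
  have hfilter : B.filter (fun ρ ↦ k ∈ h.zeroIndices (xiToH ρ)) = {xiZero b k, 1 - xiZero b k} := by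
    ext ρ
    simp only [Finset.mem_filter, hBmem, h.mem_zeroIndices_xiToH_iff, Finset.mem_insert,
      Finset.mem_singleton]
    constructor
    · rintro ⟨-, -, h'⟩; exact h'
    · rintro (rfl | rfl)
      · exact ⟨h.xiZero_mem_liZeroBox hbk hT, hbk, Or.inl rfl⟩
      · exact ⟨h.one_sub_xiZero_mem_liZeroBox hbk hT, hbk, Or.inr rfl⟩
  rw [hfilter, Finset.sum_pair (h.xiZero_ne_one_sub hbk)]

/-- The Hadamard indices with `|Im ρₖ| ≤ T` form a finite set (for them
`‖bₖ‖ = 1/(4|ρₖ − ½|²) ≥ 1/(4(|T| + ½)²)`, and `bₖ → 0`). [folklore] -/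
theorem finite_setOf_abs_im_xiZero_le (h : IsHadamardSeq 0 b) (T : ℝ) :
    {k : ℕ | b k ≠ 0 ∧ |(xiZero b k).im| ≤ T}.Finite := by
  set ε : ℝ := 1 / (4 * (|T| + 1 / 2) ^ 2) with hε
  have hε0 : 0 < ε := by positivity
  have hfin : {k : ℕ | ε ≤ ‖b k‖}.Finite := by
    have ht := (Summable.of_norm h.summable).tendsto_cofinite_zero.norm
    rw [norm_zero] at ht
    have hev : ∀ᶠ k in cofinite, ‖b k‖ < ε := ht.eventually (gt_mem_nhds hε0)
    simpa [Filter.eventually_cofinite, not_lt] using hev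
  refine hfin.subset fun k hk ↦ ?_
  obtain ⟨hbk, hT⟩ := hk
  obtain ⟨-, h0, h1, -⟩ := riemannXi_zero_prop (h.riemannXi_xiZero hbk)
  set ρ := xiZero b k with hρ
  have hsq : (ρ - 1 / 2) ^ 2 = 1 / (4 * b k) := xiZero_sub_half_sq b k
  have hb : b k = 1 / (4 * (ρ - 1 / 2) ^ 2) := by
    rw [hsq]; field_simp
  have hnorm : ‖ρ - 1 / 2‖ ≤ |T| + 1 / 2 := by
    have hre : |(ρ - 1 / 2).re| ≤ 1 / 2 := by
      rw [abs_le]; simp only [sub_re, one_div]; norm_num; constructor <;> linarith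
    have him : |(ρ - 1 / 2).im| ≤ |T| := by
      simp only [sub_im, one_div]; norm_num; exact hT.trans (le_abs_self T)
    calc ‖ρ - 1 / 2‖ ≤ |(ρ - 1 / 2).re| + |(ρ - 1 / 2).im| := Complex.norm_le_abs_re_add_abs_im _
      _ ≤ |T| + 1 / 2 := by linarith
  have hpos : 0 < ‖ρ - 1 / 2‖ := by
    refine norm_pos_iff.2 fun e ↦ ?_
    rw [e] at hsq
    simp at hsq
    exact hbk (by simpa using hsq)
  show ε ≤ ‖b k‖
  rw [hb, norm_div, norm_one, norm_mul, Complex.norm_ofNat, norm_pow, hε]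
  apply one_div_le_one_div_of_le (by positivity)
  gcongr

/-- **Cofinality of the truncations.** If `∑ₖ Gₖ = D` (unconditionally) and `Gₖ = 0` whenever
`bₖ = 0`, then the truncated sums over `{k : bₖ ≠ 0, |Im ρₖ| ≤ T}` tend to `D` as `T → ∞` (every
finite set of indices is eventually contained in a truncation). [folklore] -/
theorem tendsto_sum_truncation {G : ℕ → ℂ} {D : ℂ} (hG : HasSum G D)
    (hG0 : ∀ k, b k = 0 → G k = 0) (K : ℝ → Finset ℕ)
    (hK : ∀ T k, k ∈ K T ↔ b k ≠ 0 ∧ |(xiZero b k).im| ≤ T) :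
    Tendsto (fun T ↦ ∑ k ∈ K T, G k) atTop (𝓝 D) := by
  classical
  have hsupp : Function.support G ⊆ {k | b k ≠ 0} := fun k hk hb ↦ hk (hG0 k hb)
  have hG' : HasSum (fun k : {k // b k ≠ 0} ↦ G k) D :=
    (hasSum_subtype_iff_of_support_subset hsupp).2 hG
  let K' : ℝ → Finset {k // b k ≠ 0} := fun T ↦ (K T).subtype fun k ↦ b k ≠ 0
  have hmono : Tendsto K' atTop atTop := by
    refine tendsto_atTop.2 fun s ↦ ?_
    filter_upwards [eventually_ge_atTop (∑ k ∈ s, |(xiZero b (k : ℕ)).im|)] with T hT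
    intro k hk
    have hle : |(xiZero b (k : ℕ)).im| ≤ T :=
      (Finset.single_le_sum (f := fun k : {k // b k ≠ 0} ↦ |(xiZero b (k : ℕ)).im|)
        (fun k _ ↦ abs_nonneg _) hk).trans hT
    show k ∈ (K T).subtype fun k ↦ b k ≠ 0
    rw [Finset.mem_subtype, hK]
    exact ⟨k.2, hle⟩
  have H := hG'.comp hmono
  refine H.congr fun T ↦ ?_
  show ∑ k ∈ (K T).subtype (fun k ↦ b k ≠ 0), G k = ∑ k ∈ K T, G k
  exact Finset.sum_subtype_of_mem (f := G) fun k hk ↦ ((hK T k).1 hk).1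

end IsHadamardSeq

/-! ## Reality of the box sums -/

/-- The boxes `liZeroBox T` are stable under complex conjugation (`ζ(s̄) = conj ζ(s)`).
[folklore] -/
theorem conj_mem_liZeroBox {T : ℝ} {ρ : ℂ} (hρ : ρ ∈ liZeroBox T) : conj ρ ∈ liZeroBox T := by
  obtain ⟨hζ, h0, h1, h2, h3⟩ := hρ
  refine ⟨by rw [riemannZeta_conj, hζ, map_zero], by simpa using h0, by simpa using h1,
    by simpa using h2, by simpa using h3⟩

/-- The box sums `∑_{ρ ∈ liZeroBox T} m(ρ) [1 − (1 − 1/ρ)ⁿ]` are real: the box is conjugation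
stable and `m(ρ̄) = m(ρ)` (`riemannZetaZeroOrder_conj_holds`). [folklore] -/
theorem conj_finsum_liZeroBox (n : ℕ) (T : ℝ) :
    conj (∑ᶠ ρ ∈ liZeroBox T, (riemannZetaZeroOrder ρ : ℂ) * (1 - (1 - 1 / ρ) ^ n)) =
      ∑ᶠ ρ ∈ liZeroBox T, (riemannZetaZeroOrder ρ : ℂ) * (1 - (1 - 1 / ρ) ^ n) := by
  classical
  rw [finsum_mem_eq_finite_toFinset_sum _ (liZeroBox_finite T), map_sum]
  have hterm : ∀ ρ : ℂ, conj ((riemannZetaZeroOrder ρ : ℂ) * (1 - (1 - 1 / ρ) ^ n)) =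
      (riemannZetaZeroOrder (conj ρ) : ℂ) * (1 - (1 - 1 / conj ρ) ^ n) := by
    intro ρ
    have hm : riemannZetaZeroOrder (conj ρ) = riemannZetaZeroOrder ρ :=
      riemannZetaZeroOrder_conj_holds ρ
    rw [hm, map_mul, map_intCast, map_sub, map_one, map_pow, map_sub, map_one, map_div₀, map_one]
  simp_rw [hterm]
  set B := (liZeroBox_finite T).toFinset with hB
  have hmem : ∀ ρ, ρ ∈ B ↔ ρ ∈ liZeroBox T := fun ρ ↦ Set.Finite.mem_toFinset _
  exact Finset.sum_nbij' (fun ρ ↦ conj ρ) (fun ρ ↦ conj ρ)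
    (fun ρ hρ ↦ (hmem _).2 (conj_mem_liZeroBox ((hmem ρ).1 hρ)))
    (fun ρ hρ ↦ (hmem _).2 (conj_mem_liZeroBox ((hmem ρ).1 hρ)))
    (fun ρ _ ↦ Complex.conj_conj ρ) (fun ρ _ ↦ Complex.conj_conj ρ) fun ρ _ ↦ rfl

/-! ## Discharge of `keiperLiCoeff_eq_zero_sum` -/

/-- **rh.S26 — the Bombieri–Lagarias / Li zero-sum formula for the Keiper–Li coefficients**
(X.-J. Li, J. Number Theory 65 (1997), eq. (1.4); E. Bombieri, J. C. Lagarias, J. Number Theory 77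
(1999), Thm. 1 and (1.2)–(1.3)): for `n ≥ 1`,
`λₙ = lim_{T→∞} ∑_{ρ ∈ liZeroBox T} m(ρ) [1 − (1 − 1/ρ)ⁿ]`.
Proof: by the Hadamard product of `ξ` (`RiemannXiHadamardProduct.lean`) the series
`ξ'/ξ(s) = ∑ₖ [1/(s−ρₖ) + 1/(s−(1−ρₖ))]` converges normally near `s = 1` and may be differentiated
termwise; Leibniz' rule and the binomial theorem give
`(1/(n−1)!) dⁿ/dsⁿ[s^{n−1} log ξ]_{s=1} = ∑ₖ ([1−(1−1/ρₖ)ⁿ] + [1−(1−1/(1−ρₖ))ⁿ])`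
(`IsHadamardSeq.hasSum_keiperLi_pairs`); the pairs `{ρₖ, 1−ρₖ}` enumerate the non-trivial zeros of
`ζ` with multiplicity `m(ρ)` (`natCast_card_zeroIndices_xiToH`), so the truncations of this series
at `|Im ρₖ| ≤ T` are exactly the box sums (`finsum_liZeroBox_eq_sum`), which therefore converge to
the derivative; finally the box sums are real, so the limit is its own real part `λₙ`.
Discharges the named fact `Literature.NumberTheory.LFunctions.keiperLiCoeff_eq_zero_sum`.
[cite: Li1997, eq. (1.4)] -/
theorem keiperLiCoeff_eq_zero_sum_holds : keiperLiCoeff_eq_zero_sum := by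
  intro n hn
  classical
  obtain ⟨b, hb⟩ := exists_isHadamardSeq 0
  set D : ℂ := iteratedDeriv n (fun s : ℂ ↦ s ^ (n - 1) * Complex.log (riemannXi s)) 1 /
    ((n - 1)! : ℂ) with hD
  set f : ℂ → ℂ := fun ρ ↦ 1 - (1 - 1 / ρ) ^ n with hf
  set G : ℕ → ℂ := fun k ↦
    if b k = 0 then 0 else f (IsHadamardSeq.xiZero b k) + f (1 - IsHadamardSeq.xiZero b k)
    with hG
  have hGD : HasSum G D := hb.hasSum_keiperLi_pairs hn
  set K : ℝ → Finset ℕ := fun T ↦ (hb.finite_setOf_abs_im_xiZero_le T).toFinset with hKdef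
  have hK : ∀ T k, k ∈ K T ↔ b k ≠ 0 ∧ |(IsHadamardSeq.xiZero b k).im| ≤ T := fun T k ↦ by
    simp [hKdef, Set.Finite.mem_toFinset]
  have hlim : Tendsto (fun T ↦ ∑ k ∈ K T, G k) atTop (𝓝 D) :=
    IsHadamardSeq.tendsto_sum_truncation hGD (fun k hk ↦ by simp [hG, hk]) K hK
  have heq : ∀ T, ∑ᶠ ρ ∈ liZeroBox T, (riemannZetaZeroOrder ρ : ℂ) * f ρ = ∑ k ∈ K T, G k := by
    intro T
    rw [hb.finsum_liZeroBox_eq_sum f T (K T) (hK T)]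
    refine Finset.sum_congr rfl fun k hk ↦ ?_
    simp [hG, ((hK T k).1 hk).1]
  have hlim' : Tendsto (fun T ↦ ∑ᶠ ρ ∈ liZeroBox T, (riemannZetaZeroOrder ρ : ℂ) * f ρ)
      atTop (𝓝 D) := by
    simpa only [heq] using hlim
  -- `D` is real
  have hreal : conj D = D := by
    have h1 : Tendsto (fun T ↦ conj (∑ᶠ ρ ∈ liZeroBox T, (riemannZetaZeroOrder ρ : ℂ) * f ρ))
        atTop (𝓝 (conj D)) := (Complex.continuous_conj.tendsto D).comp hlim'
    have h2 : (fun T ↦ conj (∑ᶠ ρ ∈ liZeroBox T, (riemannZetaZeroOrder ρ : ℂ) * f ρ)) =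
        fun T ↦ ∑ᶠ ρ ∈ liZeroBox T, (riemannZetaZeroOrder ρ : ℂ) * f ρ :=
      funext fun T ↦ conj_finsum_liZeroBox n T
    rw [h2] at h1
    exact tendsto_nhds_unique h1 hlim'
  have hre : (keiperLiCoeff n : ℂ) = D := by
    rw [keiperLiCoeff]
    exact Complex.conj_eq_iff_re.1 hreal
  rw [hre]
  exact hlim'

/-- **rh.S26 — Li's criterion, unconditionally** (X.-J. Li, J. Number Theory 65 (1997), Thm. 1):
`RH ↔ λₙ ≥ 0` for all `n ≥ 1`. Both inputs of the tree's formalisation of Li's proof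
(`li_criterion_of`, `LiCriterion.lean`) are now theorems: the zero-sum formula
(`keiperLiCoeff_eq_zero_sum_holds`) and the positivity of the Taylor coefficients of `ξ` at `½`
(`xiTaylorCoeff_pos_holds`, `XiMoments.lean`). Discharges the named fact
`Literature.NumberTheory.LFunctions.li_criterion`. [cite: Li1997, Thm. 1] -/
theorem li_criterion_holds : li_criterion :=
  li_criterion_of keiperLiCoeff_eq_zero_sum_holds xiTaylorCoeff_pos_holds

end Literature.NumberTheory.LFunctions
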